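import Literature.NumberTheory.Automorphic.SmoothIndOpenCellHaarFunctional
import HarnessLib

/-!
# Transport of the cell function and of the open-cell Haar functional under right translation by an element normalising the cell

Topic `NumberTheory/Automorphic`; namespace `Literature.NumberTheory.Automorphic`.  THEOREMS ONLY (no definition, no named fact, no `sorry`,
no instance, no notation).  Registry pub/hodgecm-mathlib F0∕P3, node N1 of `F0_P3_KeysCaseTwoPaydown` (★ `U3PrincipalSeriesJacquetFiltration`,
[Casselman1995, Lemma 7.1.1 (a)]): piece T1 of the (T-ℓ) split (A-p13 (g27) holds T2∕T3) — the torus action on the open-cell line `ℓ` of the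
Jacquet module is read through the Haar functional of ★ `SmoothIndOpenCellHaarFunctional`; this file is the GENERIC transport formula.

## The mathematics ([BernsteinZelevinsky1977, §5 (5.2), Geometrical Lemma 2.12]; [Casselman1995, §6.3, proof of Thm. 6.3.5])
Frame of ★ `SmoothIndOpenCellHaarFunctional`: `H ≤ G`, `σ` a representation of `H` on `W`, `ι : Γ →* G`, `w₀ ∈ G`, the cell function
`γ ↦ f (w₀ ι(γ))` of `f ∈ Ind_H^G σ`.  Let `m ∈ G` normalise the cell: `w₀ m w₀⁻¹ ∈ H` and `ι(γ) m = m ι(c γ)` for a map `c : Γ → Γ`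
(«`c γ = m⁻¹ γ m`»; for a parabolic `P = M N`: `Γ = N`, `m ∈ M`).  Then (§1) the cell function of `m · f` is `γ ↦ σ(w₀ m w₀⁻¹) f (w₀ ι(c γ))`
(`SmoothInd.cellFun_smoothIndRep_of_conj`), and (§2) if `μ.map c = κ • μ` (the modulus of `c` on a measure `μ` of `Γ`) and `σ(w₀ m w₀⁻¹)` acts
on `W` by the scalar `s`, the Haar functional transforms by `λ(m · f) = s κ λ(f)` (`SmoothInd.integral_cellFun_smoothIndRep_of_conj`).  With
`κ = δ_P(m)` and `s = (σ∘proj ⊗ δ_P^{1/2})(w₀ m w₀⁻¹)` this is the `wχ`-reading of the open-cell term of [Casselman1995, Lemma 7.1.1 (a)]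
(the CM instance is the sequel T2∕T3).

HC_CM is proved only modulo the printed citations until rung 0 closes; this file alone discharges no named fact.

## References
* [BernsteinZelevinsky1977] I. N. Bernstein, A. V. Zelevinsky, Ann. Sci. ÉNS (4) 10 (1977), §5 (5.2), Geometrical Lemma 2.12.
* [Casselman1995] W. Casselman, *Introduction to the theory of admissible representations of `p`-adic reductive groups* (1995), §6.3
  (proof of Thm. 6.3.5), Lemma 7.1.1 (a).
-/

set_option autoImplicit false

noncomputable section

open MeasureTheory
open scoped NNReal ENNReal

namespace Literature.NumberTheory.Automorphic

/-! ## §1 The cell function of `m · f` -/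

section Cell

variable {G : Type*} [Group G] [TopologicalSpace G] [IsTopologicalGroup G] {H : Subgroup G} {W : Type*} [AddCommGroup W]
  [Module ℂ W] {σ : Representation ℂ H W} {Γ : Type*} [Group Γ] (ι : Γ →* G) (w₀ : G)

/-- **The cell function of `m · f` when `m` normalises the cell**: if `w₀ m w₀⁻¹ ∈ H` and `ι(γ) m = m ι(c γ)` for all `γ`, then
`(m · f)(w₀ ι(γ)) = f(w₀ ι(γ) m) = f((w₀ m w₀⁻¹) w₀ ι(c γ)) = σ(w₀ m w₀⁻¹) f(w₀ ι(c γ))`. [cite: BernsteinZelevinsky1977, §5 (5.2)] [cite: Casselman1995, §6.3 (proof of Thm. 6.3.5)] -/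
theorem SmoothInd.cellFun_smoothIndRep_of_conj (m : G) (hm : w₀ * m * w₀⁻¹ ∈ H) (c : Γ → Γ) (hc : ∀ γ, ι γ * m = m * ι (c γ))
    (f : Representation.SmoothInd H σ) (γ : Γ) :
    (Representation.smoothIndRep H σ m f).toFun (w₀ * ι γ) = σ ⟨w₀ * m * w₀⁻¹, hm⟩ (f.toFun (w₀ * ι (c γ))) := by
  rw [Representation.toFun_smoothIndRep_apply, mul_assoc, hc, ← mul_assoc,
    show w₀ * m * ι (c γ) = ((⟨w₀ * m * w₀⁻¹, hm⟩ : H) : G) * (w₀ * ι (c γ)) by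
      simp only [mul_assoc, inv_mul_cancel_left],
    f.toFun_subgroup_mul]

/-- the same as an identity of functions on `Γ`. [cite: BernsteinZelevinsky1977, §5 (5.2)] -/
theorem SmoothInd.cellFun_smoothIndRep_of_conj' (m : G) (hm : w₀ * m * w₀⁻¹ ∈ H) (c : Γ → Γ) (hc : ∀ γ, ι γ * m = m * ι (c γ))
    (f : Representation.SmoothInd H σ) :
    (fun γ => (Representation.smoothIndRep H σ m f).toFun (w₀ * ι γ)) = fun γ => σ ⟨w₀ * m * w₀⁻¹, hm⟩ (f.toFun (w₀ * ι (c γ))) :=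
  funext fun γ => SmoothInd.cellFun_smoothIndRep_of_conj ι w₀ m hm c hc f γ

/-- **scalar case**: if moreover `σ(w₀ m w₀⁻¹)` acts on `W` by the scalar `s`, the cell function of `m · f` is `s` times the cell function of
`f` precomposed with `c`. [cite: BernsteinZelevinsky1977, §5 (5.2)] [cite: Casselman1995, §6.3 (proof of Thm. 6.3.5)] -/
theorem SmoothInd.cellFun_smoothIndRep_of_conj_of_smul (m : G) (hm : w₀ * m * w₀⁻¹ ∈ H) (c : Γ → Γ) (hc : ∀ γ, ι γ * m = m * ι (c γ))
    {s : ℂ} (hs : ∀ w, σ ⟨w₀ * m * w₀⁻¹, hm⟩ w = s • w) (f : Representation.SmoothInd H σ) :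
    (fun γ => (Representation.smoothIndRep H σ m f).toFun (w₀ * ι γ)) = s • ((fun γ => f.toFun (w₀ * ι γ)) ∘ c) := by
  funext γ
  rw [SmoothInd.cellFun_smoothIndRep_of_conj ι w₀ m hm c hc f γ, hs, Pi.smul_apply, Function.comp_apply]

end Cell

/-! ## §2 The Haar functional of `m · f`: `λ(m · f) = s · κ · λ(f)` -/

section Integral

variable {G : Type*} [Group G] [TopologicalSpace G] [IsTopologicalGroup G] (H : Subgroup G)
  {W : Type*} [NormedAddCommGroup W] [NormedSpace ℂ W] (σ : Representation ℂ H W)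
  {Γ : Type*} [Group Γ] [TopologicalSpace Γ] [IsTopologicalGroup Γ] [MeasurableSpace Γ] [BorelSpace Γ] [SecondCountableTopologyEither Γ W]
  (ι : Γ →* G) (w₀ : G) (μ : Measure Γ)

/-- **change of variables in the Haar functional**: if `μ.map c = κ • μ` then `∫ f (w₀ ι(c γ)) dμ(γ) = κ · ∫ f (w₀ ι(γ)) dμ(γ)` (the cell
function is continuous, ★ `SmoothInd.continuous_cellFun`; Mathlib `integral_map`, `integral_smul_nnreal_measure`). [cite: Casselman1995, §6.3 (proof of Thm. 6.3.5)] -/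
theorem SmoothInd.integral_cellFun_comp_eq (hι : Continuous ι) (c : Γ → Γ) (hcm : Measurable c) {κ : ℝ≥0} (hμ : μ.map c = κ • μ)
    (f : Representation.SmoothInd H σ) :
    ∫ γ, f.toFun (w₀ * ι (c γ)) ∂μ = (κ : ℂ) • ∫ γ, f.toFun (w₀ * ι γ) ∂μ := by
  have hcont := SmoothInd.continuous_cellFun H σ ι w₀ hι f
  have h := integral_map (μ := μ) hcm.aemeasurable (f := fun γ => f.toFun (w₀ * ι γ)) hcont.aestronglyMeasurable
  rw [hμ, integral_smul_nnreal_measure] at h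
  rw [← h, NNReal.smul_def, Complex.coe_smul]

/-- **THE TRANSPORT FORMULA `λ(m · f) = s κ λ(f)`**: for `m` with `w₀ m w₀⁻¹ ∈ H`, `ι(γ) m = m ι(c γ)`, `c` measurable with `μ.map c = κ • μ`,
and `σ(w₀ m w₀⁻¹) = s` on `W`: `∫ (m·f)(w₀ ι(γ)) dμ = s κ ∫ f(w₀ ι(γ)) dμ`.  For a parabolic `P = M N` (`Γ = N`, `m ∈ M`, `c = Ad(m⁻¹)`,
`κ = δ_P(m)`, one-dimensional `σ = χ∘proj ⊗ δ_P^{1/2}`) this is the `wχ`-action on the open-cell line of the Jacquet module.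
[cite: BernsteinZelevinsky1977, §5 (5.2) and Geometrical Lemma 2.12] [cite: Casselman1995, Lemma 7.1.1 (a) and §6.3] -/
theorem SmoothInd.integral_cellFun_smoothIndRep_of_conj (hι : Continuous ι) (m : G) (hm : w₀ * m * w₀⁻¹ ∈ H) (c : Γ → Γ)
    (hcm : Measurable c) (hc : ∀ γ, ι γ * m = m * ι (c γ)) {κ : ℝ≥0} (hμ : μ.map c = κ • μ) {s : ℂ}
    (hs : ∀ w, σ ⟨w₀ * m * w₀⁻¹, hm⟩ w = s • w) (f : Representation.SmoothInd H σ) :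
    ∫ γ, (Representation.smoothIndRep H σ m f).toFun (w₀ * ι γ) ∂μ = (s * (κ : ℂ)) • ∫ γ, f.toFun (w₀ * ι γ) ∂μ := by
  rw [SmoothInd.cellFun_smoothIndRep_of_conj_of_smul ι w₀ m hm c hc hs f, mul_smul]
  change ∫ γ, s • f.toFun (w₀ * ι (c γ)) ∂μ = _
  rw [integral_smul, SmoothInd.integral_cellFun_comp_eq H σ ι w₀ μ hι c hcm hμ f]

omit [IsTopologicalGroup Γ] [MeasurableSpace Γ] [BorelSpace Γ] [SecondCountableTopologyEither Γ W] in
/-- **compact support is preserved** when `c` is a homeomorphism of `Γ`: the cell function of `m · f` has compact support if that of `f` has.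
[cite: BernsteinZelevinsky1977, §5 (5.2)] -/
theorem SmoothInd.hasCompactSupport_cellFun_smoothIndRep_of_conj (m : G) (hm : w₀ * m * w₀⁻¹ ∈ H) (c : Γ ≃ₜ Γ)
    (hc : ∀ γ, ι γ * m = m * ι (c γ)) {f : Representation.SmoothInd H σ} (hf : HasCompactSupport fun γ => f.toFun (w₀ * ι γ)) :
    HasCompactSupport fun γ => (Representation.smoothIndRep H σ m f).toFun (w₀ * ι γ) := by
  rw [SmoothInd.cellFun_smoothIndRep_of_conj' ι w₀ m hm c hc f]
  refine (hf.comp_homeomorph c).mono ?_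
  intro γ hγ
  simp only [Function.mem_support, ne_eq, Function.comp_apply] at hγ ⊢
  intro h0
  exact hγ (by rw [h0, map_zero])

end Integral

end Literature.NumberTheory.Automorphic

end
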